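import Summits.FinalStateConjecture.FinalStateConjecture.Theorems.SwallowTheDatumKerrShieldedDataExistAssemblyZones
import HarnessLib

/-!
# `ParametricKerrBurial`, line `receding-annulus-universal-collar` — stub `stub_locatedPlug` (S5a), part 1:
# the glued datum of the four radial zones WITH ITS CORE EXPORT

Support file (everything proved) for stub `stub_locatedPlug` of crux `stmt-FinalStateConjecture-10052`
(`Summit.FinalStateConjecture.FinalStateConjecture.Theses.SwallowTheDatum.ParametricKerrBurial`).
The sibling crux 10055 (`KerrShieldedDataExist`) glues its datum on `E3` from four radial zones
(`Assembly.exists_zonesData`, file `…KerrShieldedDataExistAssemblyZones`):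

  PLUG `{s < M/32}`: the plugged datum `D₀` (exactly `((1 + M/2s)⁴δ, 0)` for `s > ρ₃`, `ρ₃ < M/40`);
  BRIDGE `{M/32 ≤ s < 3M/4}`: the bridge datum `Db` on `Ω = {M/40 < s < 3M/4}`;
  KERR–SCHILD `{3M/4 ≤ s < 2M}`: the slice datum `DK = (hRep, kRep)` on `{s > 7M/10}`;
  LEAF `{s ≥ 2M}`: the leaf-zone datum `Dl` on `{s > r₁}` (`3M/4 < r₁ < 2M`; `= (hRep, kRep)` for `s < 4M`),

but only EXPORTS the agreement of the glued datum with `Dl` on the leaf zone. Our line also needs the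
agreement with `D₀` on the core ball `{s < M/32}`, which holds BY CONSTRUCTION (the glued field is
`D₀` there by definition). This file re-runs the gluing verbatim and records both exports:

* `LocatedPlug.exists_zonesData_core` — the glued VACUUM datum `D` on `E3`, `= Dl` on `{s > r₁}` (sections) and
  `= D₀` on `{s < M/32}` (sections, as equalities of bilinear forms);
* `stub_locatedPlugAux1_anchor` — its registered closed form.

References: R. Bartnik, J. Isenberg, *The constraint equations* (2004), §2; J. Corvino, Comm. Math. Phys. 214
(2000), §4 (patching data agreeing on overlaps).
-/

-- the doubled `FinalStateConjecture` path component is the summit/problem naming scheme, not a mistake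
set_option linter.dupNamespace false

noncomputable section

namespace Summit.FinalStateConjecture.FinalStateConjecture.Theorems.SwallowTheDatum.ParametricKerrBurial

open scoped Manifold ContDiff Topology BigOperators InnerProductSpace
open Bundle Set Filter Function TopologicalSpace Literature.Geometry.Lorentzian
open Literature.Geometry.Manifold (OpenSubmanifold.mfderiv_subtype_val)
open Assembly (mem_slice_zero_of_lt lt_norm_of_mem_slice_zero exists_initialDataSet_of_localData)

namespace LocatedPlug

variable {M ρ₃ r₁ : ℝ}

set_option maxHeartbeats 400000 in
/-- **The glued datum of the four radial zones, with its core export** (copy of `Assembly.exists_zonesData`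
whose conclusion also records the plug zone). Given the plugged datum `D₀` (vacuum; exactly `((1 + M/2s)⁴δ, 0)`
for `s > ρ₃`, `ρ₃ < M/40`), the bridge datum `Db` on `Ω = {M/40 < s < 3M/4}` (vacuum; inner rim isotropic
Schwarzschild, outer rim `(hRep, kRep)`), the Kerr–Schild datum `DK = (hRep, kRep)` on `{s > 7M/10}` (vacuum) and the
leaf-zone datum `Dl` on `{s > r₁}`, `3M/4 < r₁ < 2M` (vacuum; `= (hRep, kRep)` for `s < 4M`), there is a VACUUM initial
data set `D` on `E3` whose sections on the leaf zone `{s > r₁}` are those of `Dl` and whose sections on the core ball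
`{s < M/32}` are those of `D₀`. [cite: BartnikIsenberg2004, §2] -/
theorem exists_zonesData_core (hM0 : 0 < M) (hρ₃M : ρ₃ < M / 40) (hr₁a : 3 * M / 4 < r₁) (hr₁b : r₁ < 2 * M)
    (D₀ : InitialDataSet (𝓡 3) E3) (hvac₀ : ∀ [D₀.metric.HasLeviCivita], D₀.IsVacuumConstraintSolution)
    (hexact₀ : ∀ y : E3, ρ₃ < ‖y‖ →
      (∀ v w : E3, D₀.h.inner y v w = Schwarzschild.conformalFactor M y ^ 4 * ⟪v, w⟫_ℝ) ∧ D₀.k y = 0)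
    {Ω : Opens E3} (hΩ : (Ω : Set E3) = {y : E3 | M / 40 < ‖y‖ ∧ ‖y‖ < 3 * M / 4})
    (Db : InitialDataSet 𝓘(ℝ, E3) Ω) (hDbvac : ∀ [Db.metric.HasLeviCivita], Db.IsVacuumConstraintSolution)
    (hDbin : ∀ y : Ω, ‖(y : E3)‖ < M / 30 →
      (∀ v w : E3, Db.h.inner y v w = Schwarzschild.conformalFactor M (y : E3) ^ 4 * ⟪v, w⟫_ℝ) ∧ Db.k y = 0)
    (hDbout : ∀ y : Ω, 7 * M / 10 < ‖(y : E3)‖ →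
      (∀ v w : E3, Db.h.inner y v w = Kerr.hRep M (y : E3) v w) ∧ (∀ v w : E3, Db.k y v w = Kerr.kRep M (y : E3) v w))
    (DK : InitialDataSet 𝓘(ℝ, E3) (Kerr.slice 0 (7 * M / 10)))
    (hDKvac : ∀ [DK.metric.HasLeviCivita], DK.IsVacuumConstraintSolution)
    (hDK : ∀ (y : Kerr.slice 0 (7 * M / 10)) (v w : E3),
      DK.h.inner y v w = Kerr.hRep M y v w ∧ DK.k y v w = Kerr.kRep M y v w)
    (Dl : InitialDataSet 𝓘(ℝ, E3) (Kerr.slice 0 r₁))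
    (hDlvac : ∀ [Dl.metric.HasLeviCivita], Dl.IsVacuumConstraintSolution)
    (hDlnear : ∀ x : Kerr.slice 0 r₁, ‖(x : E3)‖ < 4 * M → ∀ v w : E3,
      Dl.h.inner x v w = Kerr.hRep M x v w ∧ Dl.k x v w = Kerr.kRep M x v w) :
    ∃ D : InitialDataSet (𝓡 3) E3,
      (∀ [D.metric.HasLeviCivita], D.IsVacuumConstraintSolution) ∧
      (∀ (z : E3) (hz : z ∈ Kerr.slice 0 r₁) (v w : E3),
        D.h.inner z v w = Dl.h.inner ⟨z, hz⟩ v w ∧ D.k z v w = Dl.k ⟨z, hz⟩ v w) ∧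
      ∀ z : E3, ‖z‖ < M / 32 → D.h.inner z = D₀.h.inner z ∧ D.k z = D₀.k z := by
  have hr₁ : 0 < r₁ := by linarith
  have h7 : (0 : ℝ) ≤ 7 * M / 10 := by positivity
  have hmemΩ : ∀ z : E3, z ∈ Ω ↔ M / 40 < ‖z‖ ∧ ‖z‖ < 3 * M / 4 := fun z ↦ by
    rw [← SetLike.mem_coe, hΩ]; rfl
  -- the glued fields
  set hF : E3 → E3 →L[ℝ] E3 →L[ℝ] ℝ := fun z ↦
    if ‖z‖ < M / 32 then (D₀.h.inner z : E3 →L[ℝ] E3 →L[ℝ] ℝ) else if ‖z‖ < 3 * M / 4 then Db.coordHOn z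
      else if ‖z‖ < 2 * M then DK.coordHOn z else Dl.coordHOn z with hF_def
  set kF : E3 → E3 →L[ℝ] E3 →L[ℝ] ℝ := fun z ↦
    if ‖z‖ < M / 32 then (D₀.k z : E3 →L[ℝ] E3 →L[ℝ] ℝ) else if ‖z‖ < 3 * M / 4 then Db.coordKOn z
      else if ‖z‖ < 2 * M then DK.coordKOn z else Dl.coordKOn z with kF_def
  -- the three overlaps
  have hPB : ∀ (z : E3) (hz : z ∈ Ω), ‖z‖ < M / 32 → ∀ v w : E3,
      D₀.h.inner z v w = Db.h.inner ⟨z, hz⟩ v w ∧ D₀.k z v w = Db.k ⟨z, hz⟩ v w := by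
    intro z hz hz32 v w
    have hzρ : ρ₃ < ‖z‖ := by linarith [((hmemΩ z).1 hz).1]
    obtain ⟨h1, k1⟩ := hexact₀ z hzρ
    obtain ⟨h2, k2⟩ := hDbin ⟨z, hz⟩ (by show ‖z‖ < M / 30; linarith)
    refine ⟨by rw [h1, h2], ?_⟩
    rw [k1, k2]
    rfl
  have hBK : ∀ (z : E3) (hzΩ : z ∈ Ω) (hzK : z ∈ Kerr.slice 0 (7 * M / 10)) (v w : E3),
      Db.h.inner ⟨z, hzΩ⟩ v w = DK.h.inner ⟨z, hzK⟩ v w ∧ Db.k ⟨z, hzΩ⟩ v w = DK.k ⟨z, hzK⟩ v w := by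
    intro z hzΩ hzK v w
    obtain ⟨h1, k1⟩ := hDbout ⟨z, hzΩ⟩ (lt_norm_of_mem_slice_zero h7 hzK)
    obtain ⟨h2, k2⟩ := hDK ⟨z, hzK⟩ v w
    exact ⟨by rw [h1, h2], by rw [k1, k2]⟩
  have hKL : ∀ (z : E3) (hzK : z ∈ Kerr.slice 0 (7 * M / 10)) (hzL : z ∈ Kerr.slice 0 r₁), ‖z‖ < 4 * M →
      ∀ v w : E3, DK.h.inner ⟨z, hzK⟩ v w = Dl.h.inner ⟨z, hzL⟩ v w ∧ DK.k ⟨z, hzK⟩ v w = Dl.k ⟨z, hzL⟩ v w := by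
    intro z hzK hzL hz4 v w
    obtain ⟨h1, k1⟩ := hDK ⟨z, hzK⟩ v w
    obtain ⟨h2, k2⟩ := hDlnear ⟨z, hzL⟩ hz4 v w
    exact ⟨by rw [h1, h2], by rw [k1, k2]⟩
  -- on the leaf zone the glued fields are the sections of `Dl`
  have hLz : ∀ (z : E3) (hz : z ∈ Kerr.slice 0 r₁) (v w : E3),
      hF z v w = Dl.h.inner ⟨z, hz⟩ v w ∧ kF z v w = Dl.k ⟨z, hz⟩ v w := by
    intro z hz v w
    have hzr : r₁ < ‖z‖ := lt_norm_of_mem_slice_zero hr₁.le hz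
    have hz1 : ¬‖z‖ < M / 32 := by intro h; linarith
    have hz2 : ¬‖z‖ < 3 * M / 4 := by intro h; linarith
    by_cases hz3 : ‖z‖ < 2 * M
    · have hzK : z ∈ Kerr.slice 0 (7 * M / 10) := mem_slice_zero_of_lt h7 (by linarith)
      simp only [hF_def, kF_def, if_neg hz1, if_neg hz2, if_pos hz3, DK.coordHOn_of_mem hzK, DK.coordKOn_of_mem hzK]
      exact hKL z hzK hz (by linarith) v w
    · simp only [hF_def, kF_def, if_neg hz1, if_neg hz2, if_neg hz3, Dl.coordHOn_of_mem hz, Dl.coordKOn_of_mem hz]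
      exact ⟨rfl, rfl⟩
  -- the local models
  have hloc : ∀ y : E3, ∃ (U : Opens E3) (DU : InitialDataSet 𝓘(ℝ, E3) U) (W : Set E3),
      IsOpen W ∧ y ∈ W ∧ W ⊆ U ∧ (∀ [DU.metric.HasLeviCivita], DU.IsVacuumConstraintSolution) ∧
      ∀ z (hz : z ∈ U), z ∈ W →
        (∀ v w, hF z v w = DU.h.inner ⟨z, hz⟩ v w) ∧ (∀ v w, kF z v w = DU.k ⟨z, hz⟩ v w) := by
    intro y
    by_cases hy1 : ‖y‖ < M / 32
    · -- plug
      let U : Opens E3 := ⟨Metric.ball (0 : E3) (M / 32), Metric.isOpen_ball⟩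
      haveI : D₀.metric.HasLeviCivita := PseudoRiemannianMetric.hasLeviCivita _
      haveI : (D₀.comap (Subtype.val : U → E3) (InitialDataSet.contMDiff_subtypeVal_succ U)
          (InitialDataSet.injective_mfderiv_subtypeVal U)).metric.HasLeviCivita := PseudoRiemannianMetric.hasLeviCivita _
      have hmemU : ∀ z : E3, z ∈ U ↔ ‖z‖ < M / 32 := fun z ↦ by
        show z ∈ Metric.ball (0 : E3) (M / 32) ↔ _; rw [Metric.mem_ball, dist_zero_right]
      refine ⟨U, D₀.comap (Subtype.val : U → E3) (InitialDataSet.contMDiff_subtypeVal_succ U)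
        (InitialDataSet.injective_mfderiv_subtypeVal U), (U : Set E3), U.isOpen, (hmemU y).2 hy1, subset_rfl,
        InitialDataSet.isVacuumConstraintSolution_comap' D₀ _ _ hvac₀, fun z hz _ ↦ ?_⟩
      have hz32 : ‖z‖ < M / 32 := (hmemU z).1 hz
      constructor <;> intro v w
      · rw [InitialDataSet.comap_h_inner, OpenSubmanifold.mfderiv_subtype_val]
        simp only [hF_def, if_pos hz32]
        rfl
      · rw [InitialDataSet.comap_k, OpenSubmanifold.mfderiv_subtype_val]
        simp only [kF_def, if_pos hz32]
        rfl
    by_cases hy2 : ‖y‖ < 3 * M / 4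
    · -- bridge
      refine ⟨Ω, Db, (Ω : Set E3), Ω.isOpen, (hmemΩ y).2 ⟨by linarith, hy2⟩, subset_rfl, hDbvac, fun z hz _ ↦ ?_⟩
      have hz34 : ‖z‖ < 3 * M / 4 := ((hmemΩ z).1 hz).2
      by_cases hz32 : ‖z‖ < M / 32
      · simp only [hF_def, kF_def, if_pos hz32]
        exact ⟨fun v w ↦ (hPB z hz hz32 v w).1, fun v w ↦ (hPB z hz hz32 v w).2⟩
      · simp only [hF_def, kF_def, if_neg hz32, if_pos hz34, Db.coordHOn_of_mem hz, Db.coordKOn_of_mem hz]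
        exact ⟨fun _ _ ↦ rfl, fun _ _ ↦ rfl⟩
    by_cases hy3 : ‖y‖ < 2 * M
    · -- Kerr–Schild zone
      refine ⟨Kerr.slice 0 (7 * M / 10), DK, {z : E3 | 7 * M / 10 < ‖z‖ ∧ ‖z‖ < 4 * M},
        (isOpen_lt continuous_const continuous_norm).inter (isOpen_lt continuous_norm continuous_const),
        ⟨by linarith, by linarith⟩, fun z hz ↦ mem_slice_zero_of_lt h7 hz.1, hDKvac, fun z hz hzW ↦ ?_⟩
      have hz1 : ¬‖z‖ < M / 32 := by intro h; linarith [hzW.1]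
      by_cases hz2 : ‖z‖ < 3 * M / 4
      · have hzΩ : z ∈ Ω := (hmemΩ z).2 ⟨by linarith [hzW.1], hz2⟩
        simp only [hF_def, kF_def, if_neg hz1, if_pos hz2, Db.coordHOn_of_mem hzΩ, Db.coordKOn_of_mem hzΩ]
        exact ⟨fun v w ↦ (hBK z hzΩ hz v w).1, fun v w ↦ (hBK z hzΩ hz v w).2⟩
      by_cases hz3 : ‖z‖ < 2 * M
      · simp only [hF_def, kF_def, if_neg hz1, if_neg hz2, if_pos hz3, DK.coordHOn_of_mem hz, DK.coordKOn_of_mem hz]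
        exact ⟨fun _ _ ↦ rfl, fun _ _ ↦ rfl⟩
      · have hzL : z ∈ Kerr.slice 0 r₁ := mem_slice_zero_of_lt hr₁.le (by linarith)
        simp only [hF_def, kF_def, if_neg hz1, if_neg hz2, if_neg hz3, Dl.coordHOn_of_mem hzL, Dl.coordKOn_of_mem hzL]
        exact ⟨fun v w ↦ ((hKL z hz hzL hzW.2 v w).1).symm, fun v w ↦ ((hKL z hz hzL hzW.2 v w).2).symm⟩
    · -- leaf zone
      have hyL : y ∈ Kerr.slice 0 r₁ := mem_slice_zero_of_lt hr₁.le (by linarith)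
      exact ⟨Kerr.slice 0 r₁, Dl, (Kerr.slice 0 r₁ : Set E3), (Kerr.slice 0 r₁).isOpen, hyL, subset_rfl, hDlvac,
        fun z hz _ ↦ ⟨fun v w ↦ (hLz z hz v w).1, fun v w ↦ (hLz z hz v w).2⟩⟩
  -- the glued datum
  obtain ⟨D, hDh, hDk, hDvac⟩ := exists_initialDataSet_of_localData hloc
  refine ⟨D, hDvac, fun z hz v w ↦ ⟨(hDh z v w).trans (hLz z hz v w).1, (hDk z v w).trans (hLz z hz v w).2⟩,
    fun z hz ↦ ⟨?_, ?_⟩⟩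
  · -- the core export for `h`: the glued field IS `D₀.h` on the core ball, by definition
    refine ContinuousLinearMap.ext fun v ↦ ContinuousLinearMap.ext fun w ↦ ?_
    rw [hDh z v w]
    simp only [hF_def, if_pos hz]
    rfl
  · -- the core export for `k`
    refine ContinuousLinearMap.ext fun v ↦ ContinuousLinearMap.ext fun w ↦ ?_
    rw [hDk z v w]
    simp only [kF_def, if_pos hz]
    rfl

end LocatedPlug

/-- **Registered export of this file** (aux anchor for stub `stub_locatedPlug` of crux `stmt-FinalStateConjecture-10052`):
the glued vacuum datum of the four radial zones with BOTH exports (leaf zone `= Dl`, core ball `= D₀`),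
`LocatedPlug.exists_zonesData_core` in closed form. [cite: BartnikIsenberg2004, §2] -/
theorem stub_locatedPlugAux1_anchor :
    ∀ (M ρ₃ r₁ : ℝ), 0 < M → ρ₃ < M / 40 → 3 * M / 4 < r₁ → r₁ < 2 * M → ∀ (D₀ : InitialDataSet (𝓡 3) E3), (∀ [D₀.metric.HasLeviCivita], D₀.IsVacuumConstraintSolution) → (∀ y : E3, ρ₃ < ‖y‖ → (∀ v w : E3, D₀.h.inner y v w = Schwarzschild.conformalFactor M y ^ 4 * ⟪v, w⟫_ℝ) ∧ D₀.k y = 0) → ∀ (Ω : TopologicalSpace.Opens E3), (Ω : Set E3) = {y : E3 | M / 40 < ‖y‖ ∧ ‖y‖ < 3 * M / 4} → ∀ (Db : InitialDataSet 𝓘(ℝ, E3) Ω), (∀ [Db.metric.HasLeviCivita], Db.IsVacuumConstraintSolution) → (∀ y : Ω, ‖(y : E3)‖ < M / 30 → (∀ v w : E3, Db.h.inner y v w = Schwarzschild.conformalFactor M (y : E3) ^ 4 * ⟪v, w⟫_ℝ) ∧ Db.k y = 0) → (∀ y : Ω, 7 * M / 10 < ‖(y : E3)‖ → (∀ v w :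 E3, Db.h.inner y v w = Kerr.hRep M (y : E3) v w) ∧ (∀ v w : E3, Db.k y v w = Kerr.kRep M (y : E3) v w)) → ∀ (DK : InitialDataSet 𝓘(ℝ, E3) (Kerr.slice 0 (7 * M / 10))), (∀ [DK.metric.HasLeviCivita], DK.IsVacuumConstraintSolution) → (∀ (y : Kerr.slice 0 (7 * M / 10)) (v w : E3), DK.h.inner y v w = Kerr.hRep M y v w ∧ DK.k y v w = Kerr.kRep M y v w) → ∀ (Dl : InitialDataSet 𝓘(ℝ, E3) (Kerr.slice 0 r₁)), (∀ [Dl.metric.HasLeviCivita], Dl.IsVacuumConstraintSolution) → (∀ x : Kerr.slice 0 r₁, ‖(x : E3)‖ < 4 * M → ∀ v w : E3, Dl.h.inner x v w = Kerr.hRep M x v w ∧ Dl.k x v w = Kerr.kRep M x v w) → ∃ D : InitialDataSet (𝓡 3) E3, (∀ [D.metric.HasLeviCivita], D.IsVacuumConstraintSolution) ∧ (∀ (z : E3) (hz : z ∈ Kerr.slice 0 r₁) (v w : E3), D.h.inner z v w = Dl.h.inner ⟨z, hz⟩ v w ∧ D.k z v w = Dl.k ⟨z, hz⟩ v w) ∧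 ∀ z : E3, ‖z‖ < M / 32 → D.h.inner z = D₀.h.inner z ∧ D.k z = D₀.k z :=
  fun _ _ _ hM0 hρ₃M hr₁a hr₁b D₀ hvac₀ hexact₀ _ hΩ Db hDbvac hDbin hDbout DK hDKvac hDK Dl hDlvac hDlnear ↦
    LocatedPlug.exists_zonesData_core hM0 hρ₃M hr₁a hr₁b D₀ hvac₀ hexact₀ hΩ Db hDbvac hDbin hDbout DK hDKvac hDK
      Dl hDlvac hDlnear

end Summit.FinalStateConjecture.FinalStateConjecture.Theorems.SwallowTheDatum.ParametricKerrBurial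

end
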